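import Summits.QuantumFields.YangMills.Theorems.BalabanUVNodesN11NoExpansionDiagonalCoPHSucc
import Literature.MathematicalPhysics.QuantumFieldTheory.Balaban1983to89.B16RLeafRecord13LiveGenericZS

/-!
# DAG node N11 — THE s2∕s3 JUNCTION ON THE NO-EXPANSION DIAGONAL AT THE v1.7 `CoPH` RECORD (node00-def-T FILE 27, director-ym LINES №183 H1ʰ ∕ №186 (α) ∕ №190):
# dag-n11-d's 𝐓-side clauses at the HISTORY-INDEXED residual 𝐓-weights (`…BalabanUVNodesN11NoExpansionDiagonalCoPH[Succ]`, [III] (3.24)–(3.25): generic `θ` with the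
# generation pins on `θ.zhAt p s′` DISPLAYED, and at the history-blind door of node00-def-K0a's cured family `Stage13HParams.ofHistoryBlind (Stage13RParams.ofCured θ₀)`
# with the pins DISCHARGED) + this seat's Φ-generic clause-level 𝐑-transfer (`…B16RLeafRecord13LiveGenericZS` §0, [IV] (0.3)) ⇒ THE §2 CLAUSE OF THE POST-𝐑 SLOT at
# the all-large-field sequence — at level one, at level `k+1` from `SLaw₁₃CoPH θ p k`, and at the door of the cured witness of record from `Provisos₁₃Core` + `0 < K` alone

Cell `pub-ymgap`, YM-PLAN Track A (HUMAN RULING D-0062), seat `pub-ymgap-dag-n11-e` (g10; R134 fan-out row N11∕s3 «`ThmP245Printed` via `rOperation` from N13's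
`ROpLeaf` (pairs with n13-c)»), route `BalabanUVNodes` rev 24∕25 (v1.7 `CoPH` key), helper lane (count-neutral).  [III] = [Balaban1988Convergent], [IV] = [Balaban1989LargeFieldI].
The v1.7 companion of this seat's `…BalabanUVNodesN11DiagonalLevelOneCoPR` (p535130): at v1.7 the residual 𝐓-weight factor is read PER HISTORY (`θ.zhAt p s = θ.Zh p n s.Ω s.Λ`,
DESIGN (α)), so at a GENERIC `θ : Stage13HParams` the generation pins of the diagonal step are hypotheses ON THE HISTORY's residual (`hZ`, `hq`; dag-n11-d's
`hasSect2FormAtZS_clause_one_CoPH_of_zeta0_pin`), while at the history-blind door of K0a's cured family (`Stage13HParams.ofHistoryBlind (Stage13RParams.ofCured θ₀)`, the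
K0⁷ ⟸ K0⁶ lift) they are discharged by `ZrOfRecord₁₃` (dag-n11-d's v1.6 `hasSect2FormAtZ_clause_one_ofCured_of_provisosCore`, read at the door BY `rfl`: def-T's
`rzAt_ofHistoryBlind`, `WtOfRecord₁₃H_ofHistoryBlind`).  The 𝐑-side import is this seat's `…LiveGenericZS` §0, whose clause transfer holds for an ARBITRARY right-hand side `Φ` —
so the history-indexed `sect2Slot … (θ.rzAt p s′) (WtOfRecord₁₃H θ p s′) …` is met by `rfl`, and the live-line 𝐑-chain never reads `Zh`, `Phih`, `Zr`.

WHAT THIS FILE PROVES (0 `sorry`, 0 `def`, standard axioms).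
§1 generic `θ : Stage13HParams` carrying node00-def-T's live-selector clause: `slotClause_one_allLarge_CoPH_of_pins_of_liveSel_of_rstep` — THE LEVEL-ONE POST-𝐑 CLAUSE
   «`slot₁(s′) = 0 ∨ slot₁(s′) = 𝐓₁(s′)e^{A₁(s′)}` a.e. on `supp χ₁(s′)`» at the all-large-field sequence of length 1, history-indexed residual `θ.rzAt p s′` and weights
   `WtOfRecord₁₃H θ p s′`, constant `E₁(s′) = E(p)`, EVERY term-value witness, from row `rstep`, unity of def-T's `ζ`, the two DISPLAYED pins (`hZ`: `ζ0_0` of `θ.zhAt p s′`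
   is def-T's `w₀(s′)` on the scale-0 averaging graph; `hq`: `quad_0(∅) = 0`), the joint measurability of `w₀(s′)`, `0 < K`, `1 ≤ M`;
   ★★ `slotClause_one_allLarge_CoPH_of_provisos_of_pins_of_liveSel` — the same from `h : θ.Provisos₁₃CoPH F N` (rows `rstep`, `zetaUnity`, `measω`) + the two pins;
   `slotClause_succ_allLarge_CoPH_of_provisos_of_liveSel` — level `k+1` along the all-large-field history from `SLaw₁₃CoPH θ p k`, the DISPLAYED prefix agreement `hpre`
   (director-ym №186 (2)), the generation-`k` pin, `quad_j(∅) = 0` and the displayed measurability ∕ bound of the old branch (dag-n11-d's `exists_clause_succ_CoPH_of_sLaw₁₃CoPH`).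
§2 ★★ AT EVERY HISTORY-INDEXED EXTENSION OF THE WITNESS OF RECORD `(⟨⟨theta13LiveOfRecord F N, Zr⟩, Zh, Phih⟩ : Stage13HParams F N)` (`Zr`, `Zh`, `Phih` free):
   `slotClause_one_allLarge_theta13LiveOfRecord_of_pins` — the level-one post-𝐑 clause from the two pins ON `Zh p 1 (Ω s′) (Λ s′)`, `0 < K` and the joint measurability of
   `w₀(s′)` ONLY (row `rstep`, the selector clause, unity and `M = 1` are theorems at the witness of record).
§3 ★★ AT THE DOOR OF K0a's CURED FAMILY `Stage13HParams.ofHistoryBlind (Stage13RParams.ofCured θ₀)` FROM `θ₀.Provisos₁₃Core` (the K0-class conjunct of the presenting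
   parameter; + selector clause, `0 < K`, `1 ≤ M`): `slotClause_one_allLarge_doorCured_of_provisosCore_of_liveSel` — pins DISCHARGED; ★★★
   `slotClause_one_allLarge_doorCured_theta13LiveOfRecord_of_provisosCore` — at the cured door of the witness of record from `Provisos₁₃Core` there and `0 < K` only:
   THE FIRST INSTANCE OF THEOREM 1's STEP «ρ₀ ⇒ 𝐓ρ₀ ⇒ ρ₁» ([III] p. 262) CLOSED IN KERNEL AT A v1.7 WITNESS, both arrows by name.

HONEST FRAMING.  Count-neutral kernel bookkeeping; compositions of two seats' tree theorems; the ONE new sequence per level that carries no small-field expansion —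
every other new sequence is [III] Sect. 1 ∕ §3 ∕ Thm 2 proper (the load-bearing content of (S1ᵀ), NOT here); at a generic `θ` the pins `hZ` ∕ `hq` and the prefix
agreement `hpre` are DISPLAYED hypotheses on the history's residual (whether print's R-rewritten `ζ` satisfies them off the door is [IV]'s body, unread — director-ym №186);
nothing of Bałaban asserted; N11 NOT discharged; the K1-class item NOT closed; counts unmoved.  One finite `𝕋⁴_{L^K}` programme at fixed `ε = L^{−K}`; NOT continuum ∕
OS ∕ mass-gap ∕ Clay.
-/

noncomputable section

open MeasureTheory
open scoped BigOperators Matrix.Norms.L2Operator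

namespace Summit.QuantumFields.YangMills.Theorems.BalabanUVNodesN11DiagonalLevelOneCoPH

open Literature.MathematicalPhysics.QuantumFieldTheory.Balaban1983to89 T4Continuum Node00 Node00.Tk DagBinding
open Literature.MathematicalPhysics.QuantumFieldTheory.Balaban1983to89.B16RLeafRecord13LiveGenericZS
open Literature.MathematicalPhysics.QuantumFieldTheory.Balaban1983to89.B16RLeafRecord13LiveRstep (rstep₁₃_of_liveSel_of_hasResiduals)
open Literature.MathematicalPhysics.QuantumFieldTheory.Balaban1983to89.B16RLeafRecord13AtLive (liveRepin₁₃_liveSel)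
open BalabanUVNodesN11NoExpansionDiagonalCoPR (hasSect2FormAtZ_clause_one_ofCured_of_provisosCore)
open BalabanUVNodesN11NoExpansionDiagonalCoPH (hasSect2FormAtZS_clause_one_CoPH_of_zeta0_pin hasSect2FormAtZS_clause_one_CoPH_of_provisos)
open BalabanUVNodesN11NoExpansionDiagonalCoPHSucc (exists_clause_succ_CoPH_of_sLaw₁₃CoPH)

variable {F : T4Family} {N : ℕ} [NeZero N]

/-! ## §1. At a generic `θ : Stage13HParams` carrying the live-selector clause — pins on the history's residual displayed -/

section Generic

variable (θ : Stage13HParams F N) (p : B12.RunParams)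

/-- **THE LEVEL-ONE POST-𝐑 CLAUSE OF THE LARGE-FIELD DIAGONAL AT THE v1.7 RECORD, live selector, row `rstep`, pins displayed**: for the new sequence `s′` of length 1 with
`Ω₁(s′) = ∅` and EVERY term-value witness `t`: «`slot₁(s′) = 0 ∨ slot₁(s′) = 𝐓₁(s′)e^{A₁(s′)}` `dV₁`-a.e. on `supp χ₁(s′)`» at the history's residual `θ.rzAt p s′` and weights
`WtOfRecord₁₃H θ p s′`, constant `E₁(s′) = E(p)` — dag-n11-d's identity branch for `slotT₁(s′)` under the two generation-0 pins on `θ.zhAt p s′`, followed by this seat's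
Φ-generic clause transfer (a dead `s′` is absent from `ρ₁`, a live `s′` is a fixed point of the selector where `slot = slotT` a.e. on the support).
[cite: Balaban1988Convergent, Thm 1 p.262, Theorem p.245, (3.25) p.270, (1.11) p.248, (3.16)–(3.20) pp.268–269, p.257; Balaban1989LargeFieldI, (0.3) p.176, p.177 (i)–(ii)] -/
theorem slotClause_one_allLarge_CoPH_of_pins_of_liveSel_of_rstep
    (hrstep : ∀ (p : B12.RunParams) (k : ℕ) [DecidableEq (PBond (F.P p.K) (k + 1))], k < p.K →
      (towerRepOfRecord F N θ.ν θ.τ9 (slotsTOfRecord F N θ.ν θ.τ9 (EOfRecord₁₃ F N θ.toStage13Params) (wOfRecord₉ F N θ.toStage9Params) θ.ppSel)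
        θ.ppSel p (gOfRecord₁₃ F N θ.toStage13Params p) (k + 1)).toRepData.ProvisosInt)
    (hsel : θ.ppSel = ppSelLiveOfRecord F N θ.ν θ.τ9 (EOfRecord₁₃ F N θ.toStage13Params) (wOfRecord₉ F N θ.toStage9Params))
    (hK : 0 < p.K) (hM : 1 ≤ θ.τ9.M) (hζu : IsZetaUnity F N θ.ν θ.τ9.M θ.ζ)
    (s : SeqOfRecord F θ.ν θ.τ9.M (gOfRecord₁₃ F N θ.toStage13Params p) p.K 1) (hΩ : s.Ω 1 = ∅)
    (t : Sect2.TermValues (F.P p.K) (MatA N) (FluctV N) θ.τ9.M)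
    (hZ : ∀ (V1 : GaugeField (F.P p.K) 1 (SU N)) (Uf : GaugeField (F.P p.K) 0 (SU N)),
      (θ.zhAt p s).ζ0 0 Set.univ (pairCfg (V := FluctV N) V1 Uf) =
        wOfRecord₉ F N θ.toStage9Params p (gOfRecord₁₃ F N θ.toStage13Params p) 0 s Uf ((avOfRecord F N p.K 0).avg Uf))
    (hq : ∀ (V1 : GaugeField (F.P p.K) 1 (SU N)) (Uf : GaugeField (F.P p.K) 0 (SU N)), (θ.zhAt p s).quad 0 ∅ (pairCfg (V := FluctV N) V1 Uf) = 0)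
    (hmw : Measurable fun z : GaugeField (F.P p.K) 1 (SU N) × GaugeField (F.P p.K) 0 (SU N) =>
      wOfRecord₉ F N θ.toStage9Params p (gOfRecord₁₃ F N θ.toStage13Params p) 0 s z.2 z.1) :
    slotsOfRecord F N θ.ν θ.τ9 (EOfRecord₁₃ F N θ.toStage13Params) (wOfRecord₉ F N θ.toStage9Params) θ.ppSel p
        (gOfRecord₁₃ F N θ.toStage13Params p) 1 s = 0 ∨
      ∀ᵐ V1 ∂fieldMeasure (F.P p.K) 1 (SU N),
        chiSeqOfRecord F N θ.ν θ.τ9.M (gOfRecord₁₃ F N θ.toStage13Params p) p.K 1 s V1 ≠ 0 →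
          slotsOfRecord F N θ.ν θ.τ9 (EOfRecord₁₃ F N θ.toStage13Params) (wOfRecord₉ F N θ.toStage9Params) θ.ppSel p
              (gOfRecord₁₃ F N θ.toStage13Params p) 1 s V1 =
            sect2Slot F N (FluctV N) p.K (settingOfRecord₁₃ F N θ.toStage13Params p) (θ.rzAt p s) (WtOfRecord₁₃H F N θ p s) s t
              (EOfRecord₁₃ F N θ.toStage13Params p) (UbgOfRecord₁₃CoP F N θ.toStage13Params p 1 s) V1 :=
  slotClauseΦ_succ_of_slotTClauseΦ_of_liveSel_of_rstep F N θ.toStage13Params p hrstep hsel 0 hK s _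
    fun _ => hasSect2FormAtZS_clause_one_CoPH_of_zeta0_pin θ p hK hM hζu s hΩ t hZ hq hmw

/-- **★★ THE LEVEL-ONE POST-𝐑 CLAUSE AT THE v1.7 RECORD FROM THE PROVISOS ROWS + THE TWO PINS** (+ the live-selector clause, `0 < K`, `1 ≤ M`): row `rstep` feeds the
𝐑-side, rows `zetaUnity` ∕ `measω` (through `Provisos₁₃CoPH.tstep … .measW`) feed dag-n11-d's 𝐓-side (`hasSect2FormAtZS_clause_one_CoPH_of_provisos`); the pins on the
history's residual `θ.zhAt p s′` stay displayed.  With the start `SLaw₁₃CoPH θ p 0` (def-T's `sLaw₁₃CoPH_zero`) this is THE LEVEL-ONE INSTANCE OF THEOREM 1's STEP at the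
large-field diagonal of a v1.7 record. [cite: Balaban1988Convergent, Thm 1 p.262, Theorem p.245, (3.25) p.270, (3.2)–(3.5) pp.264–265, (1.11) p.248, p.257; Balaban1989LargeFieldI, (0.3) p.176, p.177 (i)–(ii)] -/
theorem slotClause_one_allLarge_CoPH_of_provisos_of_pins_of_liveSel (h : θ.Provisos₁₃CoPH F N)
    (hsel : θ.ppSel = ppSelLiveOfRecord F N θ.ν θ.τ9 (EOfRecord₁₃ F N θ.toStage13Params) (wOfRecord₉ F N θ.toStage9Params))
    (hK : 0 < p.K) (hM : 1 ≤ θ.τ9.M)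
    (s : SeqOfRecord F θ.ν θ.τ9.M (gOfRecord₁₃ F N θ.toStage13Params p) p.K 1) (hΩ : s.Ω 1 = ∅)
    (t : Sect2.TermValues (F.P p.K) (MatA N) (FluctV N) θ.τ9.M)
    (hZ : ∀ (V1 : GaugeField (F.P p.K) 1 (SU N)) (Uf : GaugeField (F.P p.K) 0 (SU N)),
      (θ.zhAt p s).ζ0 0 Set.univ (pairCfg (V := FluctV N) V1 Uf) =
        wOfRecord₉ F N θ.toStage9Params p (gOfRecord₁₃ F N θ.toStage13Params p) 0 s Uf ((avOfRecord F N p.K 0).avg Uf))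
    (hq : ∀ (V1 : GaugeField (F.P p.K) 1 (SU N)) (Uf : GaugeField (F.P p.K) 0 (SU N)), (θ.zhAt p s).quad 0 ∅ (pairCfg (V := FluctV N) V1 Uf) = 0) :
    slotsOfRecord F N θ.ν θ.τ9 (EOfRecord₁₃ F N θ.toStage13Params) (wOfRecord₉ F N θ.toStage9Params) θ.ppSel p
        (gOfRecord₁₃ F N θ.toStage13Params p) 1 s = 0 ∨
      ∀ᵐ V1 ∂fieldMeasure (F.P p.K) 1 (SU N),
        chiSeqOfRecord F N θ.ν θ.τ9.M (gOfRecord₁₃ F N θ.toStage13Params p) p.K 1 s V1 ≠ 0 →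
          slotsOfRecord F N θ.ν θ.τ9 (EOfRecord₁₃ F N θ.toStage13Params) (wOfRecord₉ F N θ.toStage9Params) θ.ppSel p
              (gOfRecord₁₃ F N θ.toStage13Params p) 1 s V1 =
            sect2Slot F N (FluctV N) p.K (settingOfRecord₁₃ F N θ.toStage13Params p) (θ.rzAt p s) (WtOfRecord₁₃H F N θ p s) s t
              (EOfRecord₁₃ F N θ.toStage13Params p) (UbgOfRecord₁₃CoP F N θ.toStage13Params p 1 s) V1 :=
  slotClauseΦ_succ_of_slotTClauseΦ_of_liveSel_of_rstep F N θ.toStage13Params p (fun p k _ hk => h.rstep p k hk) hsel 0 hK s _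
    fun _ => hasSect2FormAtZS_clause_one_CoPH_of_provisos θ p h hK hM s hΩ t hZ hq

/-- **LEVEL `k+1` ALONG THE ALL-LARGE-FIELD HISTORY AT THE v1.7 RECORD — the post-𝐑 clause** from `SLaw₁₃CoPH θ p k`, the provisos rows, the live-selector clause, the
DISPLAYED prefix agreement of the history's residual with its initial segment's below generation `k` (director-ym №186 (2)), `quad_j(∅) = 0`, the generation-`k` pin and
the displayed measurability ∕ bound of the old branch (dag-n11-d's `exists_clause_succ_CoPH_of_sLaw₁₃CoPH`), EVERY term-value witness, constant `E_{k+1}(s′) = E_k(init s′)`.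
[cite: Balaban1988Convergent, Theorem p.245, Thm 1 p.262, (3.24)–(3.25) p.270, (2.20)–(2.22) p.258, (1.11) p.248; Balaban1989LargeFieldI, (0.3) p.176, p.177 (i)–(ii)] -/
theorem slotClause_succ_allLarge_CoPH_of_provisos_of_liveSel (h : θ.Provisos₁₃CoPH F N)
    (hsel : θ.ppSel = ppSelLiveOfRecord F N θ.ν θ.τ9 (EOfRecord₁₃ F N θ.toStage13Params) (wOfRecord₉ F N θ.toStage9Params))
    {k : ℕ} (hk : k < p.K) (hM : 1 ≤ θ.τ9.M) (hS : SLaw₁₃CoPH F N θ p k)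
    (s : SeqOfRecord F θ.ν θ.τ9.M (gOfRecord₁₃ F N θ.toStage13Params p) p.K (k + 1)) (hall : ∀ j, 1 ≤ j → j ≤ k + 1 → s.Ω j = ∅)
    (hq : ∀ (j : ℕ) (ω : MultiCfg (F.P p.K) (SU N) (FluctV N)), (θ.zhAt p s).quad j ∅ ω = 0)
    (hpre : ∀ j, j < k → (θ.zhAt p s).ζ0 j = (θ.zhAt p s.init).ζ0 j ∧ (θ.zhAt p s).quad j = (θ.zhAt p s.init).quad j)
    (hZ : ∀ (V' : GaugeField (F.P p.K) (k + 1) (SU N)) (U₀ : GaugeField (F.P p.K) k (SU N)),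
      (θ.zhAt p s).ζ0 k Set.univ (pairCfgAt (V := FluctV N) k V' U₀) =
        wOfRecord₉ F N θ.toStage9Params p (gOfRecord₁₃ F N θ.toStage13Params p) k s U₀ ((avOfRecord F N p.K k).avg U₀))
    {C : ℝ}
    (hmB : ∀ (t₀ : Sect2.TermValues (F.P p.K) (MatA N) (FluctV N) θ.τ9.M) (E₀ : ℝ), Measurable fun U₀ : GaugeField (F.P p.K) k (SU N) =>
        tkBranchOfRecord F N (FluctV N) θ.ν θ.τ9.M _ p.K (WtOfRecord₁₃H F N θ p s) s.init (fun _ => ∅) k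
          (fun ω => sect2Operand F N (FluctV N) p.K (settingOfRecord₁₃ F N θ.toStage13Params p) (θ.rzAt p s.init) s.init t₀ E₀
            (UbgOfRecord₁₃CoP F N θ.toStage13Params p k s.init) ((fun _ => ∅ : ℕ → Set (Site (F.P p.K) 0)), fun j => (ω j).2) (fun j => (ω j).1))
          (baseCfg (V := FluctV N) k U₀))
    (hCB : ∀ (t₀ : Sect2.TermValues (F.P p.K) (MatA N) (FluctV N) θ.τ9.M) (E₀ : ℝ) (U₀ : GaugeField (F.P p.K) k (SU N)),
      |tkBranchOfRecord F N (FluctV N) θ.ν θ.τ9.M _ p.K (WtOfRecord₁₃H F N θ p s) s.init (fun _ => ∅) k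
          (fun ω => sect2Operand F N (FluctV N) p.K (settingOfRecord₁₃ F N θ.toStage13Params p) (θ.rzAt p s.init) s.init t₀ E₀
            (UbgOfRecord₁₃CoP F N θ.toStage13Params p k s.init) ((fun _ => ∅ : ℕ → Set (Site (F.P p.K) 0)), fun j => (ω j).2) (fun j => (ω j).1))
          (baseCfg (V := FluctV N) k U₀)| ≤ C)
    (t' : Sect2.TermValues (F.P p.K) (MatA N) (FluctV N) θ.τ9.M) :
    ∃ E' : ℝ,
      slotsOfRecord F N θ.ν θ.τ9 (EOfRecord₁₃ F N θ.toStage13Params) (wOfRecord₉ F N θ.toStage9Params) θ.ppSel p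
          (gOfRecord₁₃ F N θ.toStage13Params p) (k + 1) s = 0 ∨
        ∀ᵐ V' ∂fieldMeasure (F.P p.K) (k + 1) (SU N),
          chiSeqOfRecord F N θ.ν θ.τ9.M (gOfRecord₁₃ F N θ.toStage13Params p) p.K (k + 1) s V' ≠ 0 →
            slotsOfRecord F N θ.ν θ.τ9 (EOfRecord₁₃ F N θ.toStage13Params) (wOfRecord₉ F N θ.toStage9Params) θ.ppSel p
                (gOfRecord₁₃ F N θ.toStage13Params p) (k + 1) s V' =
              sect2Slot F N (FluctV N) p.K (settingOfRecord₁₃ F N θ.toStage13Params p) (θ.rzAt p s) (WtOfRecord₁₃H F N θ p s) s t' E'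
                (UbgOfRecord₁₃CoP F N θ.toStage13Params p (k + 1) s) V' := by
  obtain ⟨E', hT⟩ := exists_clause_succ_CoPH_of_sLaw₁₃CoPH θ p h hk hM hS s hall hq hpre hZ hmB hCB t'
  exact ⟨E', slotClauseΦ_succ_of_slotTClauseΦ_of_liveSel_of_rstep F N θ.toStage13Params p (fun p k _ hk => h.rstep p k hk) hsel k hk s _ fun _ => hT⟩

end Generic

/-! ## §2. AT EVERY HISTORY-INDEXED EXTENSION OF THE WITNESS OF RECORD — the two generation-0 pins on `Zh` displayed -/

section OfRecord

variable (F N)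
variable (Zr : (q : B12.RunParams) → TkResidualW F N (FluctV N) q.K)
  (Zh : (q : B12.RunParams) → ℕ → (ℕ → Set (Site (F.P q.K) 0)) → (ℕ → Set (Site (F.P q.K) 0)) → TkResidualW F N (FluctV N) q.K)
  (Phih : (q : B12.RunParams) → ℕ → (ℕ → Set (Site (F.P q.K) 0)) → (ℕ → Set (Site (F.P q.K) 0)) → (ℕ → Plaq (F.P q.K) 0 → ℝ)) (p : B12.RunParams)

/-- **★★ THE LEVEL-ONE POST-𝐑 §2 CLAUSE OF THE LARGE-FIELD DIAGONAL AT EVERY HISTORY-INDEXED EXTENSION OF THE WITNESS OF RECORD** `(⟨⟨theta13LiveOfRecord F N, Zr⟩, Zh,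
Phih⟩ : Stage13HParams F N)`: for the new sequence `s′` of length 1 with `Ω₁(s′) = ∅` and EVERY term-value witness `t`, from the two generation-0 pins on the history's
residual `Zh p 1 (Ω s′) (Λ s′)`, `0 < K` and the joint measurability of `w₀(s′)` ONLY: row `rstep` and the selector clause are K0a∕K0b∕def-R theorems at the witness of
record (`rstep₁₃_of_liveSel_of_hasResiduals`, `liveRepin₁₃_liveSel`), unity of def-T's `ζ` is P4 `isZetaUnity_zeta316OfRecord` at K0b's residual, `M = 1` by the family's
numerals. [cite: Balaban1988Convergent, Thm 1 p.262, Theorem p.245, (3.25) p.270, (1.11) p.248, (3.16)–(3.22) pp.268–269, p.257; Balaban1989LargeFieldI, (0.3)–(0.4) p.176, p.177 (i)–(ii)] -/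
theorem slotClause_one_allLarge_theta13LiveOfRecord_of_pins (hK : 0 < p.K)
    (s : SeqOfRecord F (theta13LiveOfRecord F N).ν (theta13LiveOfRecord F N).τ9.M (gOfRecord₁₃ F N (theta13LiveOfRecord F N) p) p.K 1) (hΩ : s.Ω 1 = ∅)
    (t : Sect2.TermValues (F.P p.K) (MatA N) (FluctV N) (theta13LiveOfRecord F N).τ9.M)
    (hZ : ∀ (V1 : GaugeField (F.P p.K) 1 (SU N)) (Uf : GaugeField (F.P p.K) 0 (SU N)),
      (Zh p 1 s.Ω s.Λ).ζ0 0 Set.univ (pairCfg (V := FluctV N) V1 Uf) =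
        wOfRecord₉ F N (theta13LiveOfRecord F N).toStage9Params p (gOfRecord₁₃ F N (theta13LiveOfRecord F N) p) 0 s Uf ((avOfRecord F N p.K 0).avg Uf))
    (hq : ∀ (V1 : GaugeField (F.P p.K) 1 (SU N)) (Uf : GaugeField (F.P p.K) 0 (SU N)), (Zh p 1 s.Ω s.Λ).quad 0 ∅ (pairCfg (V := FluctV N) V1 Uf) = 0)
    (hmw : Measurable fun z : GaugeField (F.P p.K) 1 (SU N) × GaugeField (F.P p.K) 0 (SU N) =>
      wOfRecord₉ F N (theta13LiveOfRecord F N).toStage9Params p (gOfRecord₁₃ F N (theta13LiveOfRecord F N) p) 0 s z.2 z.1) :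
    slotsOfRecord F N (theta13LiveOfRecord F N).ν (theta13LiveOfRecord F N).τ9 (EOfRecord₁₃ F N (theta13LiveOfRecord F N))
        (wOfRecord₉ F N (theta13LiveOfRecord F N).toStage9Params) (theta13LiveOfRecord F N).ppSel p (gOfRecord₁₃ F N (theta13LiveOfRecord F N) p) 1 s = 0 ∨
      ∀ᵐ V1 ∂fieldMeasure (F.P p.K) 1 (SU N),
        chiSeqOfRecord F N (theta13LiveOfRecord F N).ν (theta13LiveOfRecord F N).τ9.M (gOfRecord₁₃ F N (theta13LiveOfRecord F N) p) p.K 1 s V1 ≠ 0 →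
          slotsOfRecord F N (theta13LiveOfRecord F N).ν (theta13LiveOfRecord F N).τ9 (EOfRecord₁₃ F N (theta13LiveOfRecord F N))
              (wOfRecord₉ F N (theta13LiveOfRecord F N).toStage9Params) (theta13LiveOfRecord F N).ppSel p (gOfRecord₁₃ F N (theta13LiveOfRecord F N) p) 1 s V1 =
            sect2Slot F N (FluctV N) p.K (settingOfRecord₁₃ F N (theta13LiveOfRecord F N) p)
              ((⟨⟨theta13LiveOfRecord F N, Zr⟩, Zh, Phih⟩ : Stage13HParams F N).rzAt p s)
              (WtOfRecord₁₃H F N (⟨⟨theta13LiveOfRecord F N, Zr⟩, Zh, Phih⟩ : Stage13HParams F N) p s) s t (EOfRecord₁₃ F N (theta13LiveOfRecord F N) p)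
              (UbgOfRecord₁₃CoP F N (theta13LiveOfRecord F N) p 1 s) V1 := by
  -- unity of def-T's `ζ` at K0b's residual, and `M = 1` by the family's numerals
  have hζu : IsZetaUnity F N (theta13LiveOfRecord F N).ν (theta13LiveOfRecord F N).τ9.M (theta13LiveOfRecord F N).ζ := by
    rw [(hasResidualsOfRecord_theta13LiveOfRecord F N).zeta_eq]
    exact isZetaUnity_zeta316OfRecord _
  have hM : 1 ≤ (theta13LiveOfRecord F N).τ9.M := le_of_eq rfl
  -- the 𝐓-side clause at the extension (its `.toStage13Params` is `θ_rec` and its `zhAt p s′` is `Zh p 1 (Ω s′) (Λ s′)`, both by `rfl`), stated EXPLICITLY there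
  have hT := hasSect2FormAtZS_clause_one_CoPH_of_zeta0_pin (⟨⟨theta13LiveOfRecord F N, Zr⟩, Zh, Phih⟩ : Stage13HParams F N) p hK hM hζu s hΩ t hZ hq hmw
  exact slotClauseΦ_succ_of_slotTClauseΦ_theta13LiveOfRecord F N p 0 hK s _ fun _ => hT

end OfRecord

/-! ## §3. AT THE HISTORY-BLIND DOOR OF node00-def-K0a's CURED FAMILY `Stage13HParams.ofHistoryBlind (Stage13RParams.ofCured θ₀)` — pins DISCHARGED -/

section DoorCured

variable (θ₀ : Stage13Params F N) (p : B12.RunParams)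

/-- **★★ THE LEVEL-ONE POST-𝐑 CLAUSE AT THE DOOR OF THE CURED FAMILY FROM `θ₀.Provisos₁₃Core` ALONE** (+ node00-def-T's live-selector clause of `θ₀`, `0 < K`,
`1 ≤ M`): dag-n11-d's v1.6 `hasSect2FormAtZ_clause_one_ofCured_of_provisosCore` (pins discharged by K0a's `ZrOfRecord₁₃`; unity ∕ measurability from the core rows), read
AT THE DOOR by `rfl` (def-T's `rzAt_ofHistoryBlind`, `WtOfRecord₁₃H_ofHistoryBlind`), followed by this seat's Φ-generic clause transfer at `θ₀` from row `rstep` — the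
K1-class knit's K0-shaped hypothesis (`Provisos₁₃Core` of the presenting parameter) is all the level-one large-field-diagonal step of Theorem 1 needs on the live line,
at v1.7 as at v1.6. [cite: Balaban1988Convergent, Thm 1 p.262, Theorem p.245, (3.25) p.270, (3.2)–(3.5) pp.264–265, (1.11) p.248; Balaban1989LargeFieldI, (0.3) p.176, p.177 (i)–(ii)] -/
theorem slotClause_one_allLarge_doorCured_of_provisosCore_of_liveSel (h : θ₀.Provisos₁₃Core F N)
    (hsel : θ₀.ppSel = ppSelLiveOfRecord F N θ₀.ν θ₀.τ9 (EOfRecord₁₃ F N θ₀) (wOfRecord₉ F N θ₀.toStage9Params)) (hK : 0 < p.K) (hM : 1 ≤ θ₀.τ9.M)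
    (s : SeqOfRecord F θ₀.ν θ₀.τ9.M (gOfRecord₁₃ F N θ₀ p) p.K 1) (hΩ : s.Ω 1 = ∅) (t : Sect2.TermValues (F.P p.K) (MatA N) (FluctV N) θ₀.τ9.M) :
    slotsOfRecord F N θ₀.ν θ₀.τ9 (EOfRecord₁₃ F N θ₀) (wOfRecord₉ F N θ₀.toStage9Params) θ₀.ppSel p (gOfRecord₁₃ F N θ₀ p) 1 s = 0 ∨
      ∀ᵐ V1 ∂fieldMeasure (F.P p.K) 1 (SU N),
        chiSeqOfRecord F N θ₀.ν θ₀.τ9.M (gOfRecord₁₃ F N θ₀ p) p.K 1 s V1 ≠ 0 →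
          slotsOfRecord F N θ₀.ν θ₀.τ9 (EOfRecord₁₃ F N θ₀) (wOfRecord₉ F N θ₀.toStage9Params) θ₀.ppSel p (gOfRecord₁₃ F N θ₀ p) 1 s V1 =
            sect2Slot F N (FluctV N) p.K (settingOfRecord₁₃ F N θ₀ p)
              ((Stage13HParams.ofHistoryBlind F N (Stage13RParams.ofCured F N θ₀)).rzAt p s)
              (WtOfRecord₁₃H F N (Stage13HParams.ofHistoryBlind F N (Stage13RParams.ofCured F N θ₀)) p s) s t
              (EOfRecord₁₃ F N θ₀ p) (UbgOfRecord₁₃CoP F N θ₀ p 1 s) V1 :=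
  slotClauseΦ_succ_of_slotTClauseΦ_of_liveSel_of_rstep F N θ₀ p (fun p k _ hk => h.rstep p k hk) hsel 0 hK s _
    fun _ => hasSect2FormAtZ_clause_one_ofCured_of_provisosCore θ₀ p h hK hM s hΩ t

end DoorCured

section DoorCuredRecord

variable (F N)
variable (p : B12.RunParams)

/-- **★★★ … AT THE DOOR OF K0a's CURED WITNESS OF RECORD `Stage13HParams.ofHistoryBlind (Stage13RParams.ofCured (theta13LiveOfRecord F N))` FROM `Provisos₁₃Core` AT THE
WITNESS AND `0 < K`** (the selector clause, row `rstep`'s use and `M = 1` are theorems there): the level-one post-𝐑 §2 clause of the large-field diagonal — Theorem 1's first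
step «ρ₀ ⇒ 𝐓ρ₀ ⇒ ρ₁» ([III] p. 262) CLOSED IN KERNEL at a v1.7 witness of record, both arrows by name (dag-n11-d 𝐓-side, this seat 𝐑-side), the K0-class conjunct
`Provisos₁₃Core` as the only displayed input. [cite: Balaban1988Convergent, Thm 1 p.262, Theorem p.245, (3.25) p.270, (1.11) p.248, (3.16)–(3.22) pp.268–269; Balaban1989LargeFieldI, (0.3)–(0.4) p.176, p.177 (i)–(ii)] -/
theorem slotClause_one_allLarge_doorCured_theta13LiveOfRecord_of_provisosCore (h : (theta13LiveOfRecord F N).Provisos₁₃Core F N) (hK : 0 < p.K)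
    (s : SeqOfRecord F (theta13LiveOfRecord F N).ν (theta13LiveOfRecord F N).τ9.M (gOfRecord₁₃ F N (theta13LiveOfRecord F N) p) p.K 1) (hΩ : s.Ω 1 = ∅)
    (t : Sect2.TermValues (F.P p.K) (MatA N) (FluctV N) (theta13LiveOfRecord F N).τ9.M) :
    slotsOfRecord F N (theta13LiveOfRecord F N).ν (theta13LiveOfRecord F N).τ9 (EOfRecord₁₃ F N (theta13LiveOfRecord F N))
        (wOfRecord₉ F N (theta13LiveOfRecord F N).toStage9Params) (theta13LiveOfRecord F N).ppSel p (gOfRecord₁₃ F N (theta13LiveOfRecord F N) p) 1 s = 0 ∨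
      ∀ᵐ V1 ∂fieldMeasure (F.P p.K) 1 (SU N),
        chiSeqOfRecord F N (theta13LiveOfRecord F N).ν (theta13LiveOfRecord F N).τ9.M (gOfRecord₁₃ F N (theta13LiveOfRecord F N) p) p.K 1 s V1 ≠ 0 →
          slotsOfRecord F N (theta13LiveOfRecord F N).ν (theta13LiveOfRecord F N).τ9 (EOfRecord₁₃ F N (theta13LiveOfRecord F N))
              (wOfRecord₉ F N (theta13LiveOfRecord F N).toStage9Params) (theta13LiveOfRecord F N).ppSel p (gOfRecord₁₃ F N (theta13LiveOfRecord F N) p) 1 s V1 =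
            sect2Slot F N (FluctV N) p.K (settingOfRecord₁₃ F N (theta13LiveOfRecord F N) p)
              ((Stage13HParams.ofHistoryBlind F N (Stage13RParams.ofCured F N (theta13LiveOfRecord F N))).rzAt p s)
              (WtOfRecord₁₃H F N (Stage13HParams.ofHistoryBlind F N (Stage13RParams.ofCured F N (theta13LiveOfRecord F N))) p s) s t
              (EOfRecord₁₃ F N (theta13LiveOfRecord F N) p) (UbgOfRecord₁₃CoP F N (theta13LiveOfRecord F N) p 1 s) V1 :=
  slotClauseΦ_succ_of_slotTClauseΦ_theta13LiveOfRecord F N p 0 hK s _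
    fun _ => hasSect2FormAtZ_clause_one_ofCured_of_provisosCore (theta13LiveOfRecord F N) p h hK (le_of_eq rfl) s hΩ t

end DoorCuredRecord

end Summit.QuantumFields.YangMills.Theorems.BalabanUVNodesN11DiagonalLevelOneCoPH

end
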